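import Literature.Probability.LatticeModels.DartPhase
import Literature.Probability.LatticeModels.DirichletGreenFunction
import Literature.Probability.LatticeModels.LatticeHarnackOneScale
import Literature.Probability.RandomPlanarGeometry.PlanarDomains
import Literature.Probability.Percolation.BoxCrossingProofs
import Summits.CriticalPhenomena.CardyFormulaZ2.Theorems.CardySusyWardParafermionPrecompactKenyonDefs
import Summits.CriticalPhenomena.CardyFormulaZ2.Theorems.CardySusyWardParafermionPrecompactTouchProfileDefs
import Summits.CriticalPhenomena.CardyFormulaZ2.Theorems.CardySusyWardParafermionPrecompactTouchProfileBoxHarnack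

/-!
# The interior Harnack modulus of the Poisson kernel of the deep sites, and (ii-b) ⇐ (i-b)
# (helper for stub `stub_touchProfileLaws`)

Line `kenyon-stream-second-relation` of the crux `ParafermionPrecompact` (route `CardySusyWard`,
item stmt-CriticalPhenomena-11293). We DISCHARGE the deterministic input `PoissonHarnackModulus D`
of `…TouchProfileDefs` for EVERY Dobrushin domain `D` (`poissonHarnackModulus`, registered helper),
whence the pair form (ii-b) of the averaged boundary touch law follows from (i-b) alone
(`pairBoundaryTouchHM_of_boundaryTouchHM`): the percolation content of STUB 5 is exactly
`BoundaryTouchHM` ([ArmHM]), `GreenDefectHM pz` and `PairGreenDefectHM pz` (`pz > 4/3`).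

Proof of the modulus. Fix a compact `K ⊂ D`, `r > 0` with `cthickening r K ⊆ D`, and `ε > 0`;
let `A, θ` be the universal constants of the box oscillation estimate `harnack_modulus_box`
(`…TouchProfileBoxHarnack`) and `N` with `A θ^N < ε`; put `L = 9^N`, `η = r / (400 L)`. For
`δ < r / (2 (192 L + 9))`, deep sites `x₀, x₁` over `K` with `|δx₀ - δx₁| < η`, and `w ∈ ∂Λ_δ`:
with `k = ⌊η/δ⌋ + 1` one has `x₁ ∈ mB x₀ k`, and every site `y` of the box `mW x₀ (2 L k)` or of
its outer boundary satisfies `closedBall (δy) (7δ) ⊆ D` (its distance to `δx₀ ∈ K` is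
`≤ 2 (96 L k + 1) δ ≤ 192 L η + (192 L + 9) δ < r`), so `y ∈ Λ_δ` and `y` is not a neighbour of
`w ∉ Λ_δ`. Hence `u = H_{Λ_δ}(·, w) = Σ_{w' ∼ w} G_{Λ_δ}(w', ·)` (symmetry of `G`) is lattice
harmonic on that box (`-Δ G_Λ(w', ·) = 𝟙_{w'}` on `Λ`, `neg_latticeLaplacianZd_dirichletGreen`) and
nonnegative everywhere (`poissonKernel_nonneg`), and `harnack_modulus_box` gives
`|u x₁ - u x₀| ≤ A θ^N u x₀ ≤ ε u x₀`.

References: G. F. Lawler, *Intersections of Random Walks* (1991), §1.4–1.5 [Lawler1991];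
G. F. Lawler, V. Limic, *Random Walk: A Modern Introduction* (2010), Thm. 6.3.8–6.3.9
[LawlerLimic2010]. Elementary given the tree; tagged `[folklore]`.
-/

noncomputable section

namespace Summit.CriticalPhenomena.CardyFormulaZ2.Cruxes.ParafermionPrecompact.KenyonStreamSecondRelation

open scoped BigOperators Topology
open Filter Set MeasureTheory
open _root_.Literature.Probability.LatticeModels
open _root_.Literature.Probability.RandomPlanarGeometry (DobrushinDomain)
open _root_.Literature.Probability.Percolation (BondConfig bondPercolation half)

/-! ### Laplacians -/

/-- The graph Laplacian of a finite sum of functions. [folklore] -/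
theorem latticeLaplacianZd_finset_sum {ι : Type*} (s : Finset ι) (f : ι → Site 2 → ℝ) (y : Site 2) :
    latticeLaplacianZd (fun x => ∑ i ∈ s, f i x) y = ∑ i ∈ s, latticeLaplacianZd (f i) y := by
  classical
  induction s using Finset.induction_on with
  | empty => simp [latticeLaplacianZd_const]
  | insert a s ha ih =>
    simp only [Finset.sum_insert ha]
    rw [show (fun x => f a x + ∑ i ∈ s, f i x) = f a + fun x => ∑ i ∈ s, f i x from rfl,
      latticeLaplacianZd_add, ih]

/-! ### Harmonicity of the Poisson kernel in its first argument -/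

/-- For `w ∉ Λ`, `x ↦ H_Λ(x, w)` is lattice harmonic (for the tree's corner-unit Laplacian
`latticeLaplacian`, which agrees with the graph Laplacian `latticeLaplacianZd` of `ℤ²`) at every
site of `Λ` not adjacent to `w` (`H_Λ(·,w) = Σ_{w' ∼ w} G_Λ(w', ·)` and `-Δ G_Λ(w', ·) = 𝟙_{w'}`
on `Λ`). [folklore] -/
theorem latticeLaplacian_poissonKernel_eq_zero (Λ : Finset (Site 2)) {w y : Site 2} (hw : w ∉ Λ)
    (hy : y ∈ Λ) (hadj : ¬ (zdGraph 2).Adj w y) :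
    latticeLaplacian (fun x => poissonKernel Λ x w) y = 0 := by
  have hfun : (fun x => poissonKernel Λ x w) =
      fun x => ∑ w' ∈ (zdGraph 2).neighborFinset w, dirichletGreen Λ w' x := by
    funext x
    rw [poissonKernel, if_neg hw]
    exact Finset.sum_congr rfl fun w' _ => dirichletGreen_comm Λ x w'
  -- the corner-unit Laplacian of the tree is the graph Laplacian of `ℤ²`
  -- (inlined; cf. `…RainbowMonomialsInExcursionKernels.latticeLaplacian_eq_latticeLaplacianZd`)
  have bridge : ∀ (H : Site 2 → ℝ) (v : Site 2), latticeLaplacian H v = latticeLaplacianZd H v := by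
    intro H v
    rw [latticeLaplacian, latticeLaplacianZd, Fin.sum_univ_four, Fin.sum_univ_two]
    simp only [cornerUnit, ← sub_eq_add_neg]
    push_cast
    ring
  rw [bridge, hfun, latticeLaplacianZd_finset_sum]
  refine Finset.sum_eq_zero fun w' hw' => ?_
  have hne : w' ≠ y := by
    rintro rfl
    exact hadj ((SimpleGraph.mem_neighborFinset _ _ _).1 hw')
  have h := neg_latticeLaplacianZd_dirichletGreen (d := 2) (by norm_num) Λ w' hy
  rw [if_neg hne, neg_eq_zero] at h
  exact h

/-! ### Mesh geometry -/

/-- Coordinatewise control of the distance of two mesh points. [folklore] -/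
theorem abs_sub_le_dist_meshPoint {δ : ℝ} (hδ : 0 < δ) (x y : Site 2) (i : Fin 2) :
    δ * |((x i : ℤ) : ℝ) - y i| ≤ dist (meshPoint δ x) (meshPoint δ y) := by
  rw [Complex.dist_eq]
  fin_cases i
  · have := Complex.abs_re_le_norm (meshPoint δ x - meshPoint δ y)
    simp only [Complex.sub_re, meshPoint_re] at this
    rwa [← mul_sub, abs_mul, abs_of_pos hδ] at this
  · have := Complex.abs_im_le_norm (meshPoint δ x - meshPoint δ y)
    simp only [Complex.sub_im, meshPoint_im] at this
    rwa [← mul_sub, abs_mul, abs_of_pos hδ] at this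

/-- The distance of two mesh points is at most `δ` times the `ℓ¹` distance of the sites. [folklore] -/
theorem dist_meshPoint_le {δ : ℝ} (hδ : 0 ≤ δ) (x y : Site 2) :
    dist (meshPoint δ x) (meshPoint δ y) ≤ δ * (|((x 0 : ℤ) : ℝ) - y 0| + |((x 1 : ℤ) : ℝ) - y 1|) := by
  rw [Complex.dist_eq]
  refine (Complex.norm_le_abs_re_add_abs_im _).trans (le_of_eq ?_)
  simp only [Complex.sub_re, Complex.sub_im, meshPoint_re, meshPoint_im, ← mul_sub, abs_mul,
    abs_of_nonneg hδ]
  ring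

/-! ### The modulus -/

/-- **The interior Harnack modulus of the Poisson kernel of the deep sites holds for every
Dobrushin domain** (registered helper for `stub_touchProfileLaws`; discharges the deterministic
input `PoissonHarnackModulus` of `…TouchProfileDefs`). [folklore] -/
theorem poissonHarnackModulus : ∀ D : DobrushinDomain, PoissonHarnackModulus D := by
  intro D K hK hKD ε hε
  obtain ⟨A, θ, hA, hθ0, hθ1, hmod⟩ := harnack_modulus_box
  obtain ⟨N, hN⟩ := exists_pow_lt_of_lt_one (div_pos hε hA) hθ1
  have hAN : A * θ ^ N ≤ ε := by
    have := (lt_div_iff₀ hA).1 hN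
    linarith [this]
  obtain ⟨r, hr, hrK⟩ := hK.exists_cthickening_subset_open D.isOpen hKD
  set L : ℕ := 9 ^ N with hL
  have hL1 : (1:ℝ) ≤ (L : ℝ) := by exact_mod_cast Nat.one_le_pow N 9 (by norm_num)
  have hLpos : (0:ℝ) < L := by linarith
  set η : ℝ := r / (400 * L) with hη
  have hηpos : 0 < η := by positivity
  refine ⟨η, hηpos, ?_⟩
  have hpos : ∀ᶠ δ in 𝓝[>] (0:ℝ), 0 < δ := eventually_mem_nhdsWithin
  have hsmall : ∀ᶠ δ in 𝓝[>] (0:ℝ), δ < r / (2 * (192 * L + 9)) :=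
    (eventually_lt_nhds (by positivity)).filter_mono nhdsWithin_le_nhds
  filter_upwards [hpos, hsmall] with δ hδ hδr
  intro x₀ hx₀ x₁ _ hx₀K _ hdist w hw
  -- the lattice scale
  set k : ℕ := ⌊η / δ⌋₊ + 1 with hk
  have hk0 : 0 < k := Nat.succ_pos _
  have hηδ : 0 ≤ η / δ := by positivity
  have hkη : η / δ < k := by rw [hk]; push_cast; exact Nat.lt_floor_add_one _
  have hkle : (k : ℝ) ≤ η / δ + 1 := by
    rw [hk]; push_cast; linarith [Nat.floor_le hηδ]
  have hkδ : (k : ℝ) * δ ≤ η + δ := by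
    have := mul_le_mul_of_nonneg_right hkle hδ.le
    rwa [add_mul, one_mul, div_mul_cancel₀ _ hδ.ne'] at this
  set Λ := deepSites D δ with hΛ
  set u : Site 2 → ℝ := fun x => poissonKernel Λ x w with hu
  set U : Set (Site 2) := mW x₀ (2 * (9 ^ N * k)) with hU
  have hwΛ : w ∉ Λ := (mem_outerBoundary_iff.1 hw).1
  -- (1) sites of `U ∪ ∂U` are within `96 L k + 1` of `x₀` in each coordinate
  have hcoord : ∀ y ∈ U ∪ latticeOuterBoundary U, ∀ i : Fin 2,
      |((y i : ℤ) : ℝ) - x₀ i| ≤ 96 * L * k + 1 := by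
    intro y hy i
    have hcast : ∀ z : Site 2, z ∈ U → |((z i : ℤ) : ℝ) - x₀ i| ≤ 96 * L * k := by
      intro z hz
      rw [hU, mem_mW_iff] at hz
      have hz' : |z i - x₀ i| ≤ 48 * ((2 * (9 ^ N * k) : ℕ) : ℤ) := by
        fin_cases i
        · exact hz.1
        · exact hz.2
      have : |((z i : ℤ) : ℝ) - x₀ i| ≤ 48 * ((2 * (9 ^ N * k) : ℕ) : ℝ) := by exact_mod_cast hz'
      rw [hL]; push_cast at this ⊢
      linarith
    rcases hy with hy | ⟨-, z, hz, j, rfl⟩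
    · linarith [hcast y hy]
    · have hz' := hcast z hz
      have hj : |((cornerUnit j i : ℤ) : ℝ)| ≤ 1 := by
        fin_cases j <;> fin_cases i <;> simp [cornerUnit]
      simp only [Pi.add_apply, Int.cast_add]
      calc |((z i : ℤ) : ℝ) + (cornerUnit j i : ℝ) - x₀ i|
          = |(((z i : ℤ) : ℝ) - x₀ i) + (cornerUnit j i : ℝ)| := by ring_nf
        _ ≤ |((z i : ℤ) : ℝ) - x₀ i| + |((cornerUnit j i : ℤ) : ℝ)| := abs_add_le _ _
        _ ≤ 96 * L * k + 1 := add_le_add hz' hj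
  -- (2) hence they are `7δ`-deep
  have hdeep : ∀ y ∈ U ∪ latticeOuterBoundary U,
      Metric.closedBall (meshPoint δ y) (7 * δ) ⊆ D.carrier := by
    intro y hy z hz
    apply hrK
    apply Metric.closedBall_subset_cthickening hx₀K r
    rw [Metric.mem_closedBall] at hz ⊢
    have h0 := hcoord y hy 0
    have h1 := hcoord y hy 1
    have hdy : dist (meshPoint δ y) (meshPoint δ x₀) ≤ δ * (2 * (96 * L * k + 1)) :=
      (dist_meshPoint_le hδ.le y x₀).trans (mul_le_mul_of_nonneg_left (by linarith) hδ.le)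
    have hLkδ : (L : ℝ) * k * δ ≤ L * (η + δ) := by
      rw [mul_assoc]; exact mul_le_mul_of_nonneg_left hkδ hLpos.le
    have hLη : (L : ℝ) * η = r / 400 := by
      rw [hη]; field_simp
    have hδr' : (192 * L + 9) * δ < r / 2 := by
      have h2 : (0:ℝ) < 2 * (192 * L + 9) := by positivity
      have := (lt_div_iff₀ h2).1 hδr
      linarith
    calc dist z (meshPoint δ x₀) ≤ dist z (meshPoint δ y) + dist (meshPoint δ y) (meshPoint δ x₀) :=
          dist_triangle _ _ _
      _ ≤ 7 * δ + δ * (2 * (96 * L * k + 1)) := add_le_add hz hdy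
      _ = 192 * (L * k * δ) + 9 * δ := by ring
      _ ≤ 192 * (L * (η + δ)) + 9 * δ := by linarith [hLkδ]
      _ = 192 * (L * η) + (192 * L + 9) * δ := by ring
      _ ≤ r := by rw [hLη]; linarith
  -- (3) `u` is lattice harmonic on `U`
  have hharm : IsLatticeHarmonicOn u U := by
    intro y hy
    have hy7 := hdeep y (Or.inl hy)
    have hyΛ : y ∈ Λ := (mem_deepSites D hδ).2
      ((Metric.closedBall_subset_closedBall (by linarith)).trans hy7)
    refine latticeLaplacian_poissonKernel_eq_zero Λ hwΛ hyΛ fun hadj => hwΛ ?_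
    refine (mem_deepSites D hδ).2 fun z hz => hy7 ?_
    rw [Metric.mem_closedBall] at hz ⊢
    calc dist z (meshPoint δ y) ≤ dist z (meshPoint δ w) + dist (meshPoint δ w) (meshPoint δ y) :=
          dist_triangle _ _ _
      _ ≤ 6 * δ + |δ| :=
          add_le_add hz (Literature.Probability.Percolation.dist_meshPoint_of_adj hadj).le
      _ = 7 * δ := by rw [abs_of_pos hδ]; ring
  have hnonneg : ∀ y ∈ U ∪ latticeOuterBoundary U, 0 ≤ u y :=
    fun y _ => poissonKernel_nonneg (by norm_num) _ _ _
  -- (4) `x₁ ∈ mB x₀ k`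
  have hx₁B : x₁ ∈ mB x₀ k := by
    have hc : ∀ i : Fin 2, |x₁ i - x₀ i| ≤ 12 * (k : ℤ) := by
      intro i
      have h1 := abs_sub_le_dist_meshPoint hδ x₁ x₀ i
      rw [dist_comm] at hdist
      have h2 : δ * |((x₁ i : ℤ) : ℝ) - x₀ i| < δ * (η / δ) := by
        rw [mul_div_cancel₀ _ hδ.ne']; exact h1.trans_lt hdist
      have h3 : |((x₁ i : ℤ) : ℝ) - x₀ i| < k := (lt_of_mul_lt_mul_left h2 hδ.le).trans hkη
      have h4 : |((x₁ i : ℤ) : ℝ) - x₀ i| ≤ 12 * (k : ℝ) := by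
        have : (0:ℝ) ≤ k := by positivity
        linarith
      have h5 : ((|x₁ i - x₀ i| : ℤ) : ℝ) ≤ ((12 * (k : ℤ) : ℤ) : ℝ) := by push_cast; exact h4
      exact_mod_cast h5
    exact ⟨hc 0, hc 1⟩
  -- (5) conclude
  have key := hmod N k hk0 u x₀ hharm hnonneg x₁ hx₁B
  have hu0 : 0 ≤ u x₀ := poissonKernel_nonneg (by norm_num) _ _ _
  calc |poissonKernel Λ x₀ w - poissonKernel Λ x₁ w| = |u x₁ - u x₀| := abs_sub_comm _ _
    _ ≤ A * θ ^ N * u x₀ := key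
    _ ≤ ε * u x₀ := mul_le_mul_of_nonneg_right hAN hu0

/-- **(ii-b) ⇐ (i-b), unconditionally.** For every Dobrushin domain and family, the pair form of
the averaged boundary touch law follows from the averaged boundary touch law. [folklore] -/
theorem pairBoundaryTouchHM_of_boundaryTouchHM (D : DobrushinDomain) (Λ : ℝ → DiscreteDobrushin)
    (hT : BoundaryTouchHM D Λ) : PairBoundaryTouchHM D Λ :=
  pairBoundaryTouchHM_of_harnack D Λ (poissonHarnackModulus D) hT

end Summit.CriticalPhenomena.CardyFormulaZ2.Cruxes.ParafermionPrecompact.KenyonStreamSecondRelation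

end
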